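import Summits.Ventures.CertifiedManyBodySolver.Observables.PairLROTowerChargedBracketAux
import Summits.Ventures.CertifiedManyBodySolver.Observables.PairLROTowerChargedLeafCellsTwisted
import Summits.Ventures.CertifiedManyBodySolver.Observables.PairLROTowerChargedLadderWords
import HarnessLib

/-!
# OP1-C, part 15: the FLIP-TWISTED orbit-state reader of the TIGHT form (auxiliary charge-density nodes)

HONEST FRAMING: first certified bounds on pairing observables; not a superconductivity verdict; a ceiling route,
never presence; nothing in this file is a number. Crew hubbard-obs (D-0042), seat hubbard-obs-p1
(`prover-hubbard-obs-p1-g9-0`, filed by `-g10-0`); lead RULINGS (ex2) d190 (custody p1), (fr) d210 («(ex2) GO», 2026-08-27). Zero compute; no definition; no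
named fact; no `sorry`.

`liminf_pairFieldLRO_le_sq_of_onePoint_chargedStationary_bound_TT'_near_aux` (PairLROTowerChargedBracketAux) replaces
the operator-norm slack constant `C_q` by two AUXILIARY one-point nodes on the charge density of the eom word. This
file is its reader for nodes exported under the FLIP-TWISTED identification (the «gbT» class of the B0 object on which
sr-mbsolver-menu-3's Stage-B cell certificates and their auxiliary `word:X` bounds are produced):

* **`liminf_pairFieldLRO_le_sq_of_onePoint_chargedStationary_twistedFlip_orbitState_bound_TT'_near_aux`** — main node
  as in PairLROTowerChargedReadingTwistedFlip (charged eom term at the grid `μ'`, ONE total-filling row), plus two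
  flip-twisted one-point nodes `c_± − A_± + μ^±₀(Re⟨ζ,N̂ζ⟩/L² − ν₀) + k_±(u − Re⟨ζ,H_Lζ⟩/L²) ≤ ∓Re ω̄^{twf}_ζ(N̂ Γ_L X − Γ_L X N̂)`
  (`k_± ≥ 0`) ⇒ `liminf_k u_k ≤ C` for every `C` above the three squares at `s = 0, ±Δ`
  (`(M + Δ·max(B₊,B₋))²` with `B_± = −(c_± − A_±)` when the squares are ordered as expected).
  The dictionary `Re ω̄^{twf}_ζ([K, Γ_L X]) = Re⟨ζ,[K, W_L]ζ⟩/L²` (PairLROTowerChargedTwistFlip) is used twice: with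
  `K = H_L − μ'N̂` for the main node and with `K = N̂` for the auxiliary nodes.

CONDITIONAL on the claim nodes and the cell datum fed in; a ceiling never speaks to presence.
References: T. Koma, H. Tasaki, J. Stat. Phys. 76 (1994) 745, Theorem 5 [KomaTasaki1994]; O. Bratteli,
D. W. Robinson, *Operator Algebras and Quantum Statistical Mechanics 2* (1997) §6.2.4 [BratteliRobinsonII1997];
W. Pusz, S. L. Woronowicz, Comm. Math. Phys. 58 (1978) 273, §1 [PuszWoronowicz1978]; D. Ruelle, *Statistical
Mechanics* (1969) §3.4 [Ruelle1969].
-/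

noncomputable section

namespace Summit.Ventures.CertifiedManyBodySolver.Observables

open Matrix Complex Finset Literature.MathematicalPhysics.QuantumLattice Literature.Probability.LatticeModels
open Literature.MathematicalPhysics.QuantumLattice.HubbardWave0 ThermodynamicLimit Filter Topology
open Literature.MathematicalPhysics.QuantumManyBody.StateRelaxation
open Summit.Ventures.CertifiedManyBodySolver.Transport
open scoped ComplexOrder ComplexConjugate BigOperators Matrix.Norms.L2Operator

/-! ### (OP1-C) in FLIP-TWISTED orbit-state form with AUXILIARY charge-density nodes -/

section FamilyAux

/-- **Flip-twisted orbit-state form of OP1-C at a grid chemical potential, TIGHT FORM** (auxiliary one-point nodes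
on the charge density instead of the operator-norm constant `C_q`). As
`liminf_pairFieldLRO_le_sq_of_onePoint_chargedStationary_twistedFlip_orbitState_bound_TT'_near` but `hXq` is replaced by
two flip-twisted one-point nodes `hauxp` / `hauxm`:
`c_± − A_± + μ^±₀(Re⟨ζ,N̂ζ⟩/L² − ν₀) + k_±(u − Re⟨ζ,H_Lζ⟩/L²) ≤ ∓ Re ω̄^{twf}_ζ(N̂ Γ_L X − Γ_L X N̂)` (`k_± ≥ 0`).
Conclusion: `liminf_k u_k ≤ C` for every `C` dominating `(c − A + μ₀(n − ν₀))²`,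
`(c + Δ(c₊ − A₊) − A + (μ₀ + Δμ⁺₀)(n − ν₀))²` and `(c + Δ(c₋ − A₋) − A + (μ₀ + Δμ⁻₀)(n − ν₀))²`.
[cite: KomaTasaki1994, Theorem 5] [cite: PuszWoronowicz1978, §1] [cite: BratteliRobinsonII1997, §6.2.4]
[cite: Ruelle1969, §3.4] -/
theorem liminf_pairFieldLRO_le_sq_of_onePoint_chargedStationary_twistedFlip_orbitState_bound_TT'_near_aux
    (t t' : ℝ) {U n : ℝ} (hU : 0 ≤ U) (hn0 : 0 < n) (hn2 : n < 2) {c A κ u μ₀ ν₀ : ℝ} (hκ : 0 ≤ κ)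
    (hu : energyDensityTT' t t' U n ≤ u) {μc μ' Δ : ℝ}
    (hμc : μc ∈ Set.Icc (chemPotMinusTT' t t' U n) (chemPotPlusTT' t t' U n)) (hnear : |μ' - μc| ≤ Δ)
    {S : Finset (DihedralGroup 4)} (hS : S.Nonempty)
    {Λ' : Finset (Site 2)} (h0 : pairRegion (insert (0 : Site 2) unitSteps) 0 ⊆ Λ')
    (X : FermionOp Λ') (hXeven : X ∈ carEvenSubalgebra (Finset.univ : Finset (Orb (PolySite Λ'))))
    (hXevenH : Xᴴ ∈ carEvenSubalgebra (Finset.univ : Finset (Orb (PolySite Λ')))) (L₁ : ℕ)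
    (hInj : ∀ L : ℕ, L₁ ≤ L → Set.InjOn (Torus.proj (d := 2) L) ↑Λ')
    {cp Ap kp μp cm Am km μm : ℝ} (hkp : 0 ≤ kp) (hkm : 0 ≤ km)
    (hauxp : ∀ (L : ℕ) [NeZero L] (hL : L₁ ≤ L) (ζ : Fock (Orb (FermionTorus 2 L))), star ζ ⬝ᵥ ζ = 1 →
      cp - Ap + μp * ((star ζ ⬝ᵥ ((totalNumber : Matrix (Finset (Orb (FermionTorus 2 L))) _ ℂ) *ᵥ ζ)).re /
          (L : ℝ) ^ 2 - ν₀) +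
        kp * (u - (star ζ ⬝ᵥ (hubbardTorusTT' L t t' U *ᵥ ζ)).re / (L : ℝ) ^ 2) ≤
        -(orbitState (twistedFlipSpaceGroupUnitary S) ζ
          ((totalNumber : Matrix (Finset (Orb (FermionTorus 2 L))) _ ℂ) * fermionEmbed (PolySite.toTorusEmb L (hInj L hL)) X -
            fermionEmbed (PolySite.toTorusEmb L (hInj L hL)) X * totalNumber)).re)
    (hauxm : ∀ (L : ℕ) [NeZero L] (hL : L₁ ≤ L) (ζ : Fock (Orb (FermionTorus 2 L))), star ζ ⬝ᵥ ζ = 1 →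
      cm - Am + μm * ((star ζ ⬝ᵥ ((totalNumber : Matrix (Finset (Orb (FermionTorus 2 L))) _ ℂ) *ᵥ ζ)).re /
          (L : ℝ) ^ 2 - ν₀) +
        km * (u - (star ζ ⬝ᵥ (hubbardTorusTT' L t t' U *ᵥ ζ)).re / (L : ℝ) ^ 2) ≤
        (orbitState (twistedFlipSpaceGroupUnitary S) ζ
          ((totalNumber : Matrix (Finset (Orb (FermionTorus 2 L))) _ ℂ) * fermionEmbed (PolySite.toTorusEmb L (hInj L hL)) X -
            fermionEmbed (PolySite.toTorusEmb L (hInj L hL)) X * totalNumber)).re)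
    (hbound : ∀ (L : ℕ) [NeZero L] (hL : L₁ ≤ L) (ζ : Fock (Orb (FermionTorus 2 L))), star ζ ⬝ᵥ ζ = 1 →
      c - A + μ₀ * ((star ζ ⬝ᵥ ((totalNumber : Matrix (Finset (Orb (FermionTorus 2 L))) _ ℂ) *ᵥ ζ)).re /
          (L : ℝ) ^ 2 - ν₀) +
        κ * (u - (star ζ ⬝ᵥ (hubbardTorusTT' L t t' U *ᵥ ζ)).re / (L : ℝ) ^ 2) +
        (orbitState (twistedFlipSpaceGroupUnitary S) ζ
          ((hubbardTorusTT' L t t' U - (μ' : ℂ) • totalNumber) * fermionEmbed (PolySite.toTorusEmb L (hInj L hL)) X -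
            fermionEmbed (PolySite.toTorusEmb L (hInj L hL)) X *
              (hubbardTorusTT' L t t' U - (μ' : ℂ) • totalNumber))).re ≤
        (orbitState (twistedFlipSpaceGroupUnitary S) ζ (fermionEmbed (PolySite.toTorusEmb L (hInj L hL))
          (-(fermionEmbed (PolySite.incl h0) (localPairAt (insert (0 : Site 2) unitSteps) dWaveFormFactor 0))))).re)
    (ψ : ∀ L, Fock (Orb (FermionTorus 2 L)))
    (hψ : ∀ L, IsGroundStateInSector (hubbardTorusTT' L t t' U) (rectN n L) 0 (ψ L))
    (hψ1 : ∀ L, star (ψ L) ⬝ᵥ ψ L = 1) {C : ℝ}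
    (hC0 : (c - A + μ₀ * (n - ν₀)) ^ 2 ≤ C)
    (hCp : (c + Δ * (cp - Ap) - A + (μ₀ + Δ * μp) * (n - ν₀)) ^ 2 ≤ C)
    (hCm : (c + Δ * (cm - Am) - A + (μ₀ + Δ * μm) * (n - ν₀)) ^ 2 ≤ C) :
    liminf (fun k : ℕ => (∑ x ∈ halfOpenBox 2 (2 * k), ∑ y ∈ halfOpenBox 2 (2 * k),
        torusPullback (pairFieldCorr dWaveFormFactor ψ) (2 * k) x y) / ((#(halfOpenBox 2 (2 * k)) : ℝ)) ^ 2) atTop ≤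
      C := by
  -- the symmetrised spin-exchanged gauge-conjugated eom word on `Ω = ⋃_γ γΛ'`
  set Ω : Finset (Site 2) := S.biUnion (fun γ => d4ShiftSet γ 0 Λ') with hΩdef
  have hsub : ∀ γ ∈ S, d4ShiftSet γ 0 Λ' ⊆ Ω := fun γ hγ =>
    Finset.subset_biUnion_of_mem (fun γ => d4ShiftSet γ 0 Λ') hγ
  set XS : FermionOp Ω := (((S.card : ℂ) * 2 * 2))⁻¹ •
    ∑ γ ∈ S.attach, ∑ f : Fin 2, ∑ m : Fin 2, fermionEmbed (PolySite.incl (hsub γ.1 γ.2))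
      (fermionEmbed (PolySite.d4Emb γ.1 0 Λ') (spinSwapIter (f : ℕ)
        (fockGauge (twistFlipExp γ.1 f m) * X * (fockGauge (twistFlipExp γ.1 f m))ᴴ))) with hXS
  have hXSeven : XS ∈ carEvenSubalgebra (Finset.univ : Finset (Orb (PolySite Ω))) :=
    twistedFlipSpaceGroupAverage_mem_carEvenSubalgebra S hsub hXeven _
  have hXSevenH : XSᴴ ∈ carEvenSubalgebra (Finset.univ : Finset (Orb (PolySite Ω))) := by
    rw [hXS, conjTranspose_twistedFlipSpaceGroupAverage S hsub X]
    exact twistedFlipSpaceGroupAverage_mem_carEvenSubalgebra S hsub hXevenH _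
  obtain ⟨DN, LN, hDN, hDD₁, hDD₂⟩ := exists_abs_re_doubleCommutator_totalNumber_le_hermitianParts XS hXSeven hXSevenH
  obtain ⟨LΩ, hLΩ⟩ := exists_forall_le_injOn_proj (d := 2) Ω
  have hInjΩ : ∀ L : ℕ, max L₁ LΩ ≤ L → Set.InjOn (Torus.proj (d := 2) L) ↑Ω :=
    fun L hL => hLΩ L (le_trans (le_max_right _ _) hL)
  -- the three squares, in the spin-resolved bookkeeping of the base theorem
  have hsq0 : (c - A + (∑ _σ : Fin 2, μ₀) * (n / 2 - ν₀ / 2)) ^ 2 ≤ C := by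
    rw [Fin.sum_univ_two, show (μ₀ + μ₀) * (n / 2 - ν₀ / 2) = μ₀ * (n - ν₀) by ring]; exact hC0
  have hsqp : (c + Δ * (cp - Ap) - A + (∑ _σ : Fin 2, (μ₀ + Δ * μp)) * (n / 2 - ν₀ / 2)) ^ 2 ≤ C := by
    rw [Fin.sum_univ_two, show (μ₀ + Δ * μp + (μ₀ + Δ * μp)) * (n / 2 - ν₀ / 2) = (μ₀ + Δ * μp) * (n - ν₀) by ring]
    exact hCp
  have hsqm : (c + Δ * (cm - Am) - A + (∑ _σ : Fin 2, (μ₀ + Δ * μm)) * (n / 2 - ν₀ / 2)) ^ 2 ≤ C := by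
    rw [Fin.sum_univ_two, show (μ₀ + Δ * μm + (μ₀ + Δ * μm)) * (n / 2 - ν₀ / 2) = (μ₀ + Δ * μm) * (n - ν₀) by ring]
    exact hCm
  -- the common dictionary: `Re ω̄^{twf}_ζ([K, Γ_L X]) = Re⟨ζ,[K, W^{XS}_L]ζ⟩/L²` for every invariant `K`
  have hdict : ∀ (L : ℕ) [NeZero L] (hL : max L₁ LΩ ≤ L) (ζ : Fock (Orb (FermionTorus 2 L)))
      (K : Matrix (Finset (Orb (FermionTorus 2 L))) (Finset (Orb (FermionTorus 2 L))) ℂ),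
      (∀ γ : DihedralGroup 4, relabel (Orb.d4Perm (L := L) γ) K = K) →
      (∀ v : TorusSite 2 L, relabel (Orb.translate v) K = K) → Commute totalNumberOp K → Commute fockSpinFlip K →
      (orbitState (twistedFlipSpaceGroupUnitary S) ζ
        (K * fermionEmbed (PolySite.toTorusEmb L (hInj L (le_trans (le_max_left _ _) hL))) X -
          fermionEmbed (PolySite.toTorusEmb L (hInj L (le_trans (le_max_left _ _) hL))) X * K)).re =
        (star ζ ⬝ᵥ ((K *
          (∑ v : TorusSite 2 L, relabel (Orb.translate v) (fermionEmbed (PolySite.toTorusEmb L (hInjΩ L hL)) XS)) -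
          (∑ v : TorusSite 2 L, relabel (Orb.translate v) (fermionEmbed (PolySite.toTorusEmb L (hInjΩ L hL)) XS)) *
            K) *ᵥ ζ)).re / (L : ℝ) ^ 2 := by
    intro L _ hL ζ K hKD hKT hKN hKF
    have hL₁ : L₁ ≤ L := le_trans (le_max_left _ _) hL
    have hcardS : ((S.card : ℂ) * 2 * 2) ≠ 0 :=
      mul_ne_zero (mul_ne_zero (Nat.cast_ne_zero.2 (Finset.card_pos.2 hS).ne') two_ne_zero) two_ne_zero
    have hcardT : (Fintype.card (TorusSite 2 L) : ℂ) = (((L : ℝ) ^ 2 : ℝ) : ℂ) := by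
      have hc : Fintype.card (TorusSite 2 L) = L ^ 2 := by simp [ZMod.card, Fintype.card_fin]
      rw [hc]; push_cast; ring
    have hW : ∑ v : TorusSite 2 L, relabel (Orb.translate v) (fermionEmbed (PolySite.toTorusEmb L (hInjΩ L hL)) XS) =
        (((S.card : ℂ) * 2 * 2))⁻¹ • ∑ γ ∈ S, ∑ f : Fin 2, ∑ m : Fin 2, (∑ v : TorusSite 2 L,
          relabel (Orb.translate v)
          (fermionEmbed (PolySite.toTorusEmb L ((injOn_proj_d4ShiftSet_iff L γ 0 Λ').2 (hInj L hL₁)))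
            (fermionEmbed (PolySite.d4Emb γ 0 Λ') (spinSwapIter (f : ℕ)
              (fockGauge (twistFlipExp γ f m) * X * (fockGauge (twistFlipExp γ f m))ᴴ))))) := by
      rw [sum_translate_twistedFlipSpaceGroupAverage_eq S (hInj L hL₁) (hInjΩ L hL) hsub X, hXS]
      simp_rw [fermionEmbed_smul, relabel_smul]
      rw [← Finset.smul_sum]
    have hsumexp : ∑ γ ∈ S, ∑ f : Fin 2, ∑ m : Fin 2, expect (K *
        (∑ v : TorusSite 2 L, relabel (Orb.translate v)
          (fermionEmbed (PolySite.toTorusEmb L ((injOn_proj_d4ShiftSet_iff L γ 0 Λ').2 (hInj L hL₁)))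
            (fermionEmbed (PolySite.d4Emb γ 0 Λ') (spinSwapIter (f : ℕ)
              (fockGauge (twistFlipExp γ f m) * X * (fockGauge (twistFlipExp γ f m))ᴴ))))) -
        (∑ v : TorusSite 2 L, relabel (Orb.translate v)
          (fermionEmbed (PolySite.toTorusEmb L ((injOn_proj_d4ShiftSet_iff L γ 0 Λ').2 (hInj L hL₁)))
            (fermionEmbed (PolySite.d4Emb γ 0 Λ') (spinSwapIter (f : ℕ)
              (fockGauge (twistFlipExp γ f m) * X * (fockGauge (twistFlipExp γ f m))ᴴ))))) * K) ζ =
        ((S.card : ℂ) * 2 * 2) * expect (K *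
          (∑ v : TorusSite 2 L, relabel (Orb.translate v) (fermionEmbed (PolySite.toTorusEmb L (hInjΩ L hL)) XS)) -
          (∑ v : TorusSite 2 L, relabel (Orb.translate v) (fermionEmbed (PolySite.toTorusEmb L (hInjΩ L hL)) XS)) *
            K) ζ := by
      rw [hW, Matrix.mul_smul, Matrix.smul_mul, ← smul_sub, Finset.mul_sum, Finset.sum_mul, ← Finset.sum_sub_distrib]
      unfold Literature.MathematicalPhysics.QuantumLattice.expect
      rw [smul_mulVec, dotProduct_smul, smul_eq_mul, ← mul_assoc, mul_inv_cancel₀ hcardS, one_mul,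
        Matrix.sum_mulVec, dotProduct_sum]
      refine Finset.sum_congr rfl fun γ _ => ?_
      rw [Finset.mul_sum, Finset.sum_mul, ← Finset.sum_sub_distrib, Matrix.sum_mulVec, dotProduct_sum]
      refine Finset.sum_congr rfl fun f _ => ?_
      rw [Finset.mul_sum, Finset.sum_mul, ← Finset.sum_sub_distrib, Matrix.sum_mulVec, dotProduct_sum]
    rw [orbitState_twistedFlipSpaceGroupUnitary_commutator_fermionEmbed_of_invariant S K hKD hKT hKN hKF
      (hInj L hL₁) X ζ]
    simp_rw [← Finset.mul_sum]
    rw [hsumexp, mul_left_comm, inv_mul_cancel_left₀ hcardS, hcardT, ← Complex.ofReal_inv,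
      Complex.re_ofReal_mul, inv_mul_eq_div]
    rfl
  refine liminf_pairFieldLRO_le_sq_of_onePoint_chargedStationary_bound_TT'_near_aux dWaveFormFactor t t' hU hn0 hn2
    (fun _ => μ₀) hκ hu hμc hnear XS hXSeven hXSevenH (max L₁ LΩ) hInjΩ LN hDN
    (fun L _ hL hLN χ hχ => hDD₁ L hLN (hInjΩ L hL) χ hχ)
    (fun L _ hL hLN χ hχ => hDD₂ L hLN (hInjΩ L hL) χ hχ)
    (cp := cp) (Ap := Ap) (cm := cm) (Am := Am) (fun _ => μp) (fun _ => μm) hkp hkm ?_ ?_ ?_ ψ hψ hψ1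
    hsq0 hsqp hsqm
  · -- auxiliary node, sense `+`
    intro L _ hL ζ hζ
    have hL₁ : L₁ ≤ L := le_trans (le_max_left _ _) hL
    have hKD : ∀ γ : DihedralGroup 4, relabel (Orb.d4Perm (L := L) γ)
        (totalNumber : Matrix (Finset (Orb (FermionTorus 2 L))) _ ℂ) = totalNumber := fun γ => by
      rw [Orb.d4Perm_eq_mapEquiv, relabel_mapEquiv_totalNumber]
    have hKT : ∀ v : TorusSite 2 L, relabel (Orb.translate v)
        (totalNumber : Matrix (Finset (Orb (FermionTorus 2 L))) _ ℂ) = totalNumber := fun v => by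
      rw [Orb.translate, relabel_mapEquiv_totalNumber]
    have hKN : Commute totalNumberOp (totalNumber : Matrix (Finset (Orb (FermionTorus 2 L))) _ ℂ) := by
      rw [totalNumberOp_eq_totalNumber]
    have h := hauxp L hL₁ ζ hζ
    rw [hdict L hL ζ totalNumber hKD hKT hKN fockSpinFlip_commute_totalNumber,
      ← sum_spin_filling_eq_total ζ μp ν₀] at h
    exact h
  · -- auxiliary node, sense `−`
    intro L _ hL ζ hζ
    have hL₁ : L₁ ≤ L := le_trans (le_max_left _ _) hL
    have hKD : ∀ γ : DihedralGroup 4, relabel (Orb.d4Perm (L := L) γ)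
        (totalNumber : Matrix (Finset (Orb (FermionTorus 2 L))) _ ℂ) = totalNumber := fun γ => by
      rw [Orb.d4Perm_eq_mapEquiv, relabel_mapEquiv_totalNumber]
    have hKT : ∀ v : TorusSite 2 L, relabel (Orb.translate v)
        (totalNumber : Matrix (Finset (Orb (FermionTorus 2 L))) _ ℂ) = totalNumber := fun v => by
      rw [Orb.translate, relabel_mapEquiv_totalNumber]
    have hKN : Commute totalNumberOp (totalNumber : Matrix (Finset (Orb (FermionTorus 2 L))) _ ℂ) := by
      rw [totalNumberOp_eq_totalNumber]
    have h := hauxm L hL₁ ζ hζ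
    rw [hdict L hL ζ totalNumber hKD hKT hKN fockSpinFlip_commute_totalNumber,
      ← sum_spin_filling_eq_total ζ μm ν₀] at h
    exact h
  · -- the main node
    intro L _ hL ζ hζ
    have hL₁ : L₁ ≤ L := le_trans (le_max_left _ _) hL
    set K : Matrix (Finset (Orb (FermionTorus 2 L))) (Finset (Orb (FermionTorus 2 L))) ℂ :=
      hubbardTorusTT' L t t' U - (μ' : ℂ) • totalNumber with hK
    have hKD : ∀ γ : DihedralGroup 4, relabel (Orb.d4Perm (L := L) γ) K = K := fun γ =>
      relabel_d4Perm_hubbardTorusTT'_sub_smul_totalNumber γ t t' U _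
    have hKT : ∀ v : TorusSite 2 L, relabel (Orb.translate v) K = K := fun v =>
      relabel_translate_hubbardTorusTT'_sub_smul_totalNumber v t t' U _
    have hKN : Commute totalNumberOp K := by
      rw [hK, totalNumberOp_eq_totalNumber]
      exact ((hubbardTorusTT'_commute_totalNumber L t t' U).symm).sub_right ((Commute.refl _).smul_right _)
    have hKF : Commute fockSpinFlip K :=
      (fockSpinFlip_commute_hubbardTorusTT' t t' U).sub_right ((fockSpinFlip_commute_totalNumber).smul_right _)
    have h := hbound L hL₁ ζ hζ
    rw [fermionEmbed_neg, map_neg, Complex.neg_re,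
      re_orbitState_twistedFlipSpaceGroupUnitary_localPairAt hS h0 (hInj L hL₁) ζ, hdict L hL ζ K hKD hKT hKN hKF,
      ← sum_spin_filling_eq_total ζ μ₀ ν₀] at h
    exact h

end FamilyAux


/-! ### The registry consumers of the tight form: point leaf and cell leaf -/

section ConsumerAux

variable {tp U n : ℝ} {hi c' : ℚ}

/-- **FLIP-TWISTED OP1-C CELL LEAF, TIGHT FORM (producer form).** As
`ObsPairLROCeilingAt_of_onePoint_charged_twistedFlip_orbitState_gridCells_bound_sq` (PairLROTowerChargedLeafCellsTwisted)
with, per cell `j`, the operator-norm charge bound `hXq` REPLACED by the two auxiliary flip-twisted one-point nodes of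
cell `j` (constants `cp j, Ap j, kp j ≥ 0, μp j` and `cm j, Am j, km j ≥ 0, μm j`); conclusion
`ObsPairLROCeilingAt t′ U n c′` at every rational `c′` dominating, for every cell, the three squares at `s = 0, ±Δ_j`.
[cite: KomaTasaki1994, Theorem 5] [cite: Ruelle1969, §3.4] -/
theorem ObsPairLROCeilingAt_of_onePoint_charged_twistedFlip_orbitState_gridCells_bound_sq_aux (hU : 0 ≤ U)
    (hn0 : 0 < n) (hn2 : n < 2) (hE : energyDensityTT' 1 tp U n ≤ ((hi : ℚ) : ℝ)) {J : ℕ} (m : Fin (J + 2) → ℝ)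
    (hm : Monotone m) (hlo : m 0 ≤ chemPotMinusTT' 1 tp U n) (hhi' : chemPotPlusTT' 1 tp U n ≤ m (Fin.last (J + 1)))
    (μ' Δ : Fin (J + 1) → ℝ) (hleft : ∀ j, μ' j - Δ j ≤ m j.castSucc) (hright : ∀ j, m j.succ ≤ μ' j + Δ j)
    (c A κ u μ₀ ν₀ : Fin (J + 1) → ℝ) (hκ : ∀ j, 0 ≤ κ j) (hhi : ∀ j, ((hi : ℚ) : ℝ) ≤ u j)
    (cp Ap kp μp cm Am km μm : Fin (J + 1) → ℝ) (hkp : ∀ j, 0 ≤ kp j) (hkm : ∀ j, 0 ≤ km j)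
    {S : Finset (DihedralGroup 4)} (hS : S.Nonempty)
    {Λ' : Finset (Site 2)} (h0 : pairRegion (insert (0 : Site 2) unitSteps) 0 ⊆ Λ')
    (X : Fin (J + 1) → FermionOp Λ')
    (hXeven : ∀ j, X j ∈ carEvenSubalgebra (Finset.univ : Finset (Orb (PolySite Λ'))))
    (hXevenH : ∀ j, (X j)ᴴ ∈ carEvenSubalgebra (Finset.univ : Finset (Orb (PolySite Λ')))) (L₁ : ℕ)
    (hInj : ∀ L : ℕ, L₁ ≤ L → Set.InjOn (Torus.proj (d := 2) L) ↑Λ')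
    (hauxp : ∀ j, ∀ (L : ℕ) [NeZero L] (hL : L₁ ≤ L) (ζ : Fock (Orb (FermionTorus 2 L))), star ζ ⬝ᵥ ζ = 1 →
      cp j - Ap j + μp j * ((star ζ ⬝ᵥ ((totalNumber : Matrix (Finset (Orb (FermionTorus 2 L))) _ ℂ) *ᵥ ζ)).re /
          (L : ℝ) ^ 2 - ν₀ j) +
        kp j * (u j - (star ζ ⬝ᵥ (hubbardTorusTT' L 1 tp U *ᵥ ζ)).re / (L : ℝ) ^ 2) ≤
        -(orbitState (twistedFlipSpaceGroupUnitary S) ζ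
          ((totalNumber : Matrix (Finset (Orb (FermionTorus 2 L))) _ ℂ) *
              fermionEmbed (PolySite.toTorusEmb L (hInj L hL)) (X j) -
            fermionEmbed (PolySite.toTorusEmb L (hInj L hL)) (X j) * totalNumber)).re)
    (hauxm : ∀ j, ∀ (L : ℕ) [NeZero L] (hL : L₁ ≤ L) (ζ : Fock (Orb (FermionTorus 2 L))), star ζ ⬝ᵥ ζ = 1 →
      cm j - Am j + μm j * ((star ζ ⬝ᵥ ((totalNumber : Matrix (Finset (Orb (FermionTorus 2 L))) _ ℂ) *ᵥ ζ)).re /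
          (L : ℝ) ^ 2 - ν₀ j) +
        km j * (u j - (star ζ ⬝ᵥ (hubbardTorusTT' L 1 tp U *ᵥ ζ)).re / (L : ℝ) ^ 2) ≤
        (orbitState (twistedFlipSpaceGroupUnitary S) ζ
          ((totalNumber : Matrix (Finset (Orb (FermionTorus 2 L))) _ ℂ) *
              fermionEmbed (PolySite.toTorusEmb L (hInj L hL)) (X j) -
            fermionEmbed (PolySite.toTorusEmb L (hInj L hL)) (X j) * totalNumber)).re)
    (hbound : ∀ j, ∀ (L : ℕ) [NeZero L] (hL : L₁ ≤ L) (ζ : Fock (Orb (FermionTorus 2 L))), star ζ ⬝ᵥ ζ = 1 →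
      c j - A j + μ₀ j * ((star ζ ⬝ᵥ ((totalNumber : Matrix (Finset (Orb (FermionTorus 2 L))) _ ℂ) *ᵥ ζ)).re /
          (L : ℝ) ^ 2 - ν₀ j) +
        κ j * (u j - (star ζ ⬝ᵥ (hubbardTorusTT' L 1 tp U *ᵥ ζ)).re / (L : ℝ) ^ 2) +
        (orbitState (twistedFlipSpaceGroupUnitary S) ζ
          ((hubbardTorusTT' L 1 tp U - (μ' j : ℂ) • totalNumber) * fermionEmbed (PolySite.toTorusEmb L (hInj L hL)) (X j) -
            fermionEmbed (PolySite.toTorusEmb L (hInj L hL)) (X j) *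
              (hubbardTorusTT' L 1 tp U - (μ' j : ℂ) • totalNumber))).re ≤
        (orbitState (twistedFlipSpaceGroupUnitary S) ζ (fermionEmbed (PolySite.toTorusEmb L (hInj L hL))
          (-(fermionEmbed (PolySite.incl h0)
            (localPairAt (insert (0 : Site 2) unitSteps) dWaveFormFactor 0))))).re)
    (hc0 : ∀ j, (c j - A j + μ₀ j * (n - ν₀ j)) ^ 2 ≤ ((c' : ℚ) : ℝ))
    (hcp : ∀ j, (c j + Δ j * (cp j - Ap j) - A j + (μ₀ j + Δ j * μp j) * (n - ν₀ j)) ^ 2 ≤ ((c' : ℚ) : ℝ))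
    (hcm : ∀ j, (c j + Δ j * (cm j - Am j) - A j + (μ₀ j + Δ j * μm j) * (n - ν₀ j)) ^ 2 ≤ ((c' : ℚ) : ℝ)) :
    ObsPairLROCeilingAt tp U n c' := by
  have hmp := chemPotMinusTT'_le_chemPotPlusTT' 1 tp hU hn0 hn2
  obtain ⟨j, hj⟩ := exists_mem_Icc_castSucc_succ_of_monotone hm
    (x := chemPotMinusTT' 1 tp U n) ⟨hlo, hmp.trans hhi'⟩
  have hnear : |μ' j - chemPotMinusTT' 1 tp U n| ≤ Δ j :=
    abs_sub_le_iff.2 ⟨by linarith [hj.1, hleft j], by linarith [hj.2, hright j]⟩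
  intro ψ hψ hψ1
  exact liminf_pairFieldLRO_le_sq_of_onePoint_chargedStationary_twistedFlip_orbitState_bound_TT'_near_aux 1 tp hU
    hn0 hn2 (hκ j) (hE.trans (hhi j)) ⟨le_rfl, hmp⟩ hnear hS h0 (X j) (hXeven j) (hXevenH j) L₁ hInj (hkp j) (hkm j)
    (hauxp j) (hauxm j) (hbound j) ψ hψ hψ1 (hc0 j) (hcp j) (hcm j)

end ConsumerAux


/-! ### Assembling the auxiliary node from per-generator one-point nodes (linearity) -/

section Assembly

variable {L : ℕ} [NeZero L] {Λ' : Finset (Site 2)}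

/-- **Sum of flip-twisted one-point nodes = node for the sum of the words.** If for every `i ∈ s` the word `Y_i ∈ 𝔄_{Λ'}`
carries a flip-twisted one-point node `c_i − A_i + m_i(Re⟨ζ,N̂ζ⟩/L² − ν₀) + k_i(u − Re⟨ζ,H_Lζ⟩/L²) ≤ Re ω̄^{twf}_ζ(Γ_L Y_i)`
(e.g. the producer's auxiliary `word:X` certificates, oriented and scaled by nonnegative weights), then the summed data give
the node for `Σ_i Y_i` — the shape of `hauxp` / `hauxm` once `Σ_i Y_i = ∓(N̂_{Λ'}X − XN̂_{Λ'})`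
(`totalNumberOp_commutator_sum_smul_ladderWord`, PairLROTowerChargedLadderWords; `re_orbitState_totalNumber_commutator_fermionEmbed`).
[cite: KomaTasaki1994, Theorem 5] [cite: BratteliRobinsonII1997, §6.2.4] -/
theorem twistedFlip_onePoint_node_sum {κι : Type*} (s : Finset κι) (S : Finset (DihedralGroup 4)) (t t' U u ν₀ : ℝ)
    (c A m k : κι → ℝ) (Y : κι → FermionOp Λ') (h : Set.InjOn (Torus.proj (d := 2) L) ↑Λ')
    (ζ : Fock (Orb (FermionTorus 2 L)))
    (hnode : ∀ i ∈ s,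
      c i - A i + m i * ((star ζ ⬝ᵥ ((totalNumber : Matrix (Finset (Orb (FermionTorus 2 L))) _ ℂ) *ᵥ ζ)).re /
          (L : ℝ) ^ 2 - ν₀) +
        k i * (u - (star ζ ⬝ᵥ (hubbardTorusTT' L t t' U *ᵥ ζ)).re / (L : ℝ) ^ 2) ≤
        (orbitState (twistedFlipSpaceGroupUnitary S) ζ (fermionEmbed (PolySite.toTorusEmb L h) (Y i))).re) :
    (∑ i ∈ s, c i) - (∑ i ∈ s, A i) +
        (∑ i ∈ s, m i) * ((star ζ ⬝ᵥ ((totalNumber : Matrix (Finset (Orb (FermionTorus 2 L))) _ ℂ) *ᵥ ζ)).re /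
          (L : ℝ) ^ 2 - ν₀) +
        (∑ i ∈ s, k i) * (u - (star ζ ⬝ᵥ (hubbardTorusTT' L t t' U *ᵥ ζ)).re / (L : ℝ) ^ 2) ≤
      (orbitState (twistedFlipSpaceGroupUnitary S) ζ (fermionEmbed (PolySite.toTorusEmb L h) (∑ i ∈ s, Y i))).re := by
  have hsum := Finset.sum_le_sum hnode
  rw [fermionEmbed_sum, map_sum, Complex.re_sum]
  refine le_of_eq_of_le ?_ hsum
  simp only [Finset.sum_add_distrib, Finset.sum_sub_distrib, Finset.sum_mul]

/-- The charge commutator of an embedded word, read in any orbit state: `Re ω̄(N̂ Γ_L X − Γ_L X N̂) = Re ω̄(Γ_L(N̂_{Λ'}X − XN̂_{Λ'}))`.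
[cite: BratteliRobinsonII1997, §5.2.2] -/
theorem re_orbitState_totalNumber_commutator_fermionEmbed {G : Type*} [Fintype G]
    (T : G → Matrix (Finset (Orb (FermionTorus 2 L))) (Finset (Orb (FermionTorus 2 L))) ℂ)
    (h : Set.InjOn (Torus.proj (d := 2) L) ↑Λ') (X : FermionOp Λ') (ζ : Fock (Orb (FermionTorus 2 L))) :
    (orbitState T ζ ((totalNumber : Matrix (Finset (Orb (FermionTorus 2 L))) _ ℂ) * fermionEmbed (PolySite.toTorusEmb L h) X -
        fermionEmbed (PolySite.toTorusEmb L h) X * totalNumber)).re =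
      (orbitState T ζ (fermionEmbed (PolySite.toTorusEmb L h) ((totalNumberOp : FermionOp Λ') * X - X * totalNumberOp))).re := by
  rw [← totalNumberOp_eq_totalNumber, totalNumberOp_commutator_fermionEmbed]

/-- **Scaling a flip-twisted one-point node by a weight `b ≥ 0`** gives the node for `b • Y` (orient a `word:X` certificate
of either sense, then weight it by `|λ_X q_X|`). [cite: KomaTasaki1994, Theorem 5] -/
theorem twistedFlip_onePoint_node_smul (S : Finset (DihedralGroup 4)) (t t' U u ν₀ : ℝ) {b c A m k : ℝ} (hb : 0 ≤ b)
    (Y : FermionOp Λ') (h : Set.InjOn (Torus.proj (d := 2) L) ↑Λ') (ζ : Fock (Orb (FermionTorus 2 L)))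
    (hnode : c - A + m * ((star ζ ⬝ᵥ ((totalNumber : Matrix (Finset (Orb (FermionTorus 2 L))) _ ℂ) *ᵥ ζ)).re /
          (L : ℝ) ^ 2 - ν₀) +
        k * (u - (star ζ ⬝ᵥ (hubbardTorusTT' L t t' U *ᵥ ζ)).re / (L : ℝ) ^ 2) ≤
        (orbitState (twistedFlipSpaceGroupUnitary S) ζ (fermionEmbed (PolySite.toTorusEmb L h) Y)).re) :
    b * c - b * A + (b * m) * ((star ζ ⬝ᵥ ((totalNumber : Matrix (Finset (Orb (FermionTorus 2 L))) _ ℂ) *ᵥ ζ)).re /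
          (L : ℝ) ^ 2 - ν₀) +
        (b * k) * (u - (star ζ ⬝ᵥ (hubbardTorusTT' L t t' U *ᵥ ζ)).re / (L : ℝ) ^ 2) ≤
      (orbitState (twistedFlipSpaceGroupUnitary S) ζ (fermionEmbed (PolySite.toTorusEmb L h) (((b : ℝ) : ℂ) • Y))).re := by
  have hmul := mul_le_mul_of_nonneg_left hnode hb
  rw [fermionEmbed_smul, map_smul, smul_eq_mul, Complex.re_ofReal_mul]
  refine le_of_eq_of_le ?_ hmul
  ring

end Assembly

end Summit.Ventures.CertifiedManyBodySolver.Observables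

end
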